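import Summits.Ventures.QEC.Basic.HypergraphProductSector
import Summits.Ventures.QEC.Census.ClassicalDistCert

/-!
# Flattening `HGP(H₁, H₂)` to the census layout: the gens-file check lists ARE the hypergraph product (kernel bridge)

LADDER-QEC (venture cell `qec`), PARTITION v2.3 item 04.HGPK. qec-search-4's gens files (census/search-4/gens/<set>/
<id>.json, the objects kernels A/B certify and ref-1 recomputes, identified by `matrix_sha256`) list the `X`- and
`Z`-checks of `HGPsym(H1, H2eff)` as supports over FLAT qubit indices with the layout (README §1, every file's
`construction.qubit_layout`): qubit `(i, j) ↦ i·n₂ + j` (`i < n₁`, `j < n₂`), qubit `(a, b) ↦ n₁n₂ + a·m₂ + b`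
(`a < m₁`, `b < m₂`); `X`-check `(a, j)` = row `a·n₂ + j` of `HX`; `Z`-check `(i, b)` = row `i·m₂ + b` of `HZ`. The
census theorems `Census/HGP/*.lean` are about `HGP.code (rowMatrix n₁ H₁) (rowMatrix n₂ H₂)` on the structured qubit
type `(Fin n₁ × Fin n₂) ⊕ (Fin m₁ × Fin m₂)`. This file is the kernel BRIDGE between the two:

* `hgpXRows n₁ n₂ H₁ H₂`, `hgpZRows n₁ n₂ H₁ H₂ : List ℕ` — the flat check rows as numerals (computable; `decide` /
  `rfl` evaluate them to the gens lists), built from `spread` (place the bits of a word at an arithmetic progression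
  of positions);
* `HX_eq_submatrix_flat`, `HZ_eq_submatrix_flat` — `HGP.HX/HZ (rowMatrix n₁ H₁) (rowMatrix n₂ H₂)` is the flat
  row-list matrix re-indexed along the layout equivalences `qubitEquiv` (`= (finProdFinEquiv ⊕ finProdFinEquiv) ≫
  finSumFinEquiv`, i.e. exactly `(i,j) ↦ i·n₂ + j`, `(a,b) ↦ n₁n₂ + a·m₂ + b`) and `xRowEquiv` / `zRowEquiv`;
* `CSSCode.isCode_iff_of_submatrix_equiv` — `[[n,k,d]]` (type-02's `CSSCode.IsCode`) is invariant under relabelling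
  qubits and checks along equivalences; hence `HGP.isCode_flat`: a census theorem for `HGP.code …` gives the same
  `[[n, k, d]]` for the CSS code with the FLAT check matrices `rowMatrix N (hgpXRows …)`, `rowMatrix N (hgpZRows …)`
  (commutation `flat_comm` included), so a row file can state `[[n,k,d]]` for the literal gens numerals.

HONEST FRAMING: pure re-indexing; no distance is computed here. Everything is elementary [folklore]; the layout is
qec-search-4's (census/search-4/README.md §1).
-/

namespace Summit.Ventures.QEC.Census

open Matrix Literature.InformationTheory.QuantumCodes
open Literature.InformationTheory.Coding (minDist)

/-! ## Bit placement -/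

/-- `spread w stride off len` = the numeral with bit `off + i·stride` set for every `i < len` with bit `i` of `w` set
(the bits of `w` placed along an arithmetic progression). Column: definition (computable). [folklore] -/
def spread (w stride off len : ℕ) : ℕ :=
  ((List.range len).filter fun i => w.testBit i).foldr (fun i acc => 2 ^ (off + i * stride) ||| acc) 0

/-- Bits of an `|||`-fold of powers of two. [folklore] -/
theorem testBit_foldr_two_pow (l : List ℕ) (f : ℕ → ℕ) (q : ℕ) :
    (l.foldr (fun i acc => 2 ^ f i ||| acc) 0).testBit q = true ↔ ∃ i ∈ l, f i = q := by
  induction l with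
  | nil => simp
  | cons a l ih =>
    rw [List.foldr_cons, Nat.testBit_or, Bool.or_eq_true, ih, Nat.testBit_two_pow, decide_eq_true_iff]
    simp

/-- Bits of `spread`: bit `q` is set iff `q = off + i·stride` for some `i < len` with bit `i` of `w` set. [folklore] -/
theorem testBit_spread (w stride off len q : ℕ) :
    (spread w stride off len).testBit q = true ↔ ∃ i, i < len ∧ w.testBit i = true ∧ off + i * stride = q := by
  rw [spread, testBit_foldr_two_pow]
  simp only [List.mem_filter, List.mem_range, and_assoc]

/-! ## The flat check rows of `HGP(H₁, H₂)` -/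

/-- The `X`-check `(a, j)` of `HGP(H₁,H₂)` as a flat numeral: bits `i·n₂ + j` for `i ∈ supp H₁[a]` (block
`H₁ ⊗ 1`) and bits `n₁n₂ + a·m₂ + b` for the rows `b` of `H₂` containing `j` (block `1 ⊗ H₂ᵀ`). [folklore] -/
def xRow (n₁ n₂ : ℕ) (H₁ H₂ : List ℕ) (a j : ℕ) : ℕ :=
  spread (H₁.getD a 0) n₂ j n₁ ||| spread (colMask H₂ j) 1 (n₁ * n₂ + a * H₂.length) H₂.length

/-- The `Z`-check `(i, b)` of `HGP(H₁,H₂)` as a flat numeral: bits `i·n₂ + j` for `j ∈ supp H₂[b]` (block `1 ⊗ H₂`)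
and bits `n₁n₂ + a·m₂ + b` for the rows `a` of `H₁` containing `i` (block `H₁ᵀ ⊗ 1`). [folklore] -/
def zRow (n₁ n₂ : ℕ) (H₁ H₂ : List ℕ) (i b : ℕ) : ℕ :=
  spread (H₂.getD b 0) 1 (i * n₂) n₂ ||| spread (colMask H₁ i) H₂.length (n₁ * n₂ + b) H₁.length

/-- The flat `X`-check list of `HGP(H₁,H₂)`: row `a·n₂ + j` = check `(a, j)` (qec-search-4 layout). [folklore] -/
def hgpXRows (n₁ n₂ : ℕ) (H₁ H₂ : List ℕ) : List ℕ :=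
  (List.range (H₁.length * n₂)).map fun r => xRow n₁ n₂ H₁ H₂ (r / n₂) (r % n₂)

/-- The flat `Z`-check list of `HGP(H₁,H₂)`: row `i·m₂ + b` = check `(i, b)` (qec-search-4 layout). [folklore] -/
def hgpZRows (n₁ n₂ : ℕ) (H₁ H₂ : List ℕ) : List ℕ :=
  (List.range (n₁ * H₂.length)).map fun r => zRow n₁ n₂ H₁ H₂ (r / H₂.length) (r % H₂.length)

/-- Number of flat `X`-checks. [folklore] -/
@[simp] theorem length_hgpXRows (n₁ n₂ : ℕ) (H₁ H₂ : List ℕ) : (hgpXRows n₁ n₂ H₁ H₂).length = H₁.length * n₂ := by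
  simp [hgpXRows]

/-- Number of flat `Z`-checks. [folklore] -/
@[simp] theorem length_hgpZRows (n₁ n₂ : ℕ) (H₁ H₂ : List ℕ) : (hgpZRows n₁ n₂ H₁ H₂).length = n₁ * H₂.length := by
  simp [hgpZRows]

/-! ## The layout equivalences -/

/-- The qubit layout: `(i, j) ↦ i·n₂ + j`, `(a, b) ↦ n₁n₂ + a·m₂ + b` (Mathlib's `finProdFinEquiv` on each block, then
`finSumFinEquiv`). [folklore] -/
def qubitEquiv (n₁ n₂ m₁ m₂ : ℕ) : ((Fin n₁ × Fin n₂) ⊕ (Fin m₁ × Fin m₂)) ≃ Fin (n₁ * n₂ + m₁ * m₂) :=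
  (Equiv.sumCongr finProdFinEquiv finProdFinEquiv).trans finSumFinEquiv

/-- Value of the layout on a block-one qubit: `(i, j) ↦ i·n₂ + j`. [folklore] -/
theorem qubitEquiv_inl_val (n₁ n₂ m₁ m₂ : ℕ) (i : Fin n₁) (j : Fin n₂) :
    ((qubitEquiv n₁ n₂ m₁ m₂ (Sum.inl (i, j)) : Fin _) : ℕ) = (j : ℕ) + n₂ * i := by
  simp [qubitEquiv, finProdFinEquiv]

/-- Value of the layout on a block-two qubit: `(a, b) ↦ n₁n₂ + a·m₂ + b`. [folklore] -/
theorem qubitEquiv_inr_val (n₁ n₂ m₁ m₂ : ℕ) (a : Fin m₁) (b : Fin m₂) :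
    ((qubitEquiv n₁ n₂ m₁ m₂ (Sum.inr (a, b)) : Fin _) : ℕ) = n₁ * n₂ + ((b : ℕ) + m₂ * a) := by
  simp [qubitEquiv, finProdFinEquiv]

/-- The `X`-check layout `(a, j) ↦ a·n₂ + j`, into the index type of the flat list. [folklore] -/
def xRowEquiv (n₁ n₂ : ℕ) (H₁ H₂ : List ℕ) : (Fin H₁.length × Fin n₂) ≃ Fin (hgpXRows n₁ n₂ H₁ H₂).length :=
  finProdFinEquiv.trans (finCongr (length_hgpXRows n₁ n₂ H₁ H₂).symm)

/-- The `Z`-check layout `(i, b) ↦ i·m₂ + b`. [folklore] -/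
def zRowEquiv (n₁ n₂ : ℕ) (H₁ H₂ : List ℕ) : (Fin n₁ × Fin H₂.length) ≃ Fin (hgpZRows n₁ n₂ H₁ H₂).length :=
  finProdFinEquiv.trans (finCongr (length_hgpZRows n₁ n₂ H₁ H₂).symm)

/-- Value of the `X`-check layout. [folklore] -/
theorem xRowEquiv_val (n₁ n₂ : ℕ) (H₁ H₂ : List ℕ) (a : Fin H₁.length) (j : Fin n₂) :
    ((xRowEquiv n₁ n₂ H₁ H₂ (a, j) : Fin _) : ℕ) = (j : ℕ) + n₂ * a := by
  simp [xRowEquiv, finProdFinEquiv]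

/-- Value of the `Z`-check layout. [folklore] -/
theorem zRowEquiv_val (n₁ n₂ : ℕ) (H₁ H₂ : List ℕ) (i : Fin n₁) (b : Fin H₂.length) :
    ((zRowEquiv n₁ n₂ H₁ H₂ (i, b) : Fin _) : ℕ) = (b : ℕ) + H₂.length * i := by
  simp [zRowEquiv, finProdFinEquiv]

/-! ## Arithmetic of the layout -/

/-- Positions within block one determine `(i, j)`: `j + n₂ i = j' + n₂ i'` with `j, j' < n₂` forces equality. [folklore] -/
theorem blockOne_inj {n₂ i j i' j' : ℕ} (hj : j < n₂) (hj' : j' < n₂) (h : j + n₂ * i = j' + n₂ * i') :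
    i = i' ∧ j = j' := by
  have h1 : (j + n₂ * i) / n₂ = i := by rw [Nat.add_mul_div_left _ _ (by omega), Nat.div_eq_of_lt hj, zero_add]
  have h2 : (j' + n₂ * i') / n₂ = i' := by rw [Nat.add_mul_div_left _ _ (by omega), Nat.div_eq_of_lt hj', zero_add]
  have hi : i = i' := by rw [← h1, ← h2, h]
  subst hi
  exact ⟨rfl, by omega⟩

/-- A block-one position is below `n₁n₂`. [folklore] -/
theorem blockOne_lt {n₁ n₂ i j : ℕ} (hi : i < n₁) (hj : j < n₂) : j + n₂ * i < n₁ * n₂ := by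
  calc j + n₂ * i < n₂ + n₂ * i := by omega
    _ = n₂ * (i + 1) := by ring
    _ ≤ n₂ * n₁ := Nat.mul_le_mul_left _ hi
    _ = n₁ * n₂ := Nat.mul_comm _ _

/-! ## Entries of the flat rows -/

/-- Row `a·n₂ + j` of the flat `X`-list is `xRow a j`. [folklore] -/
theorem getElem_hgpXRows (n₁ n₂ : ℕ) (H₁ H₂ : List ℕ) (a : Fin H₁.length) (j : Fin n₂)
    (h : (j : ℕ) + n₂ * a < (hgpXRows n₁ n₂ H₁ H₂).length) :
    (hgpXRows n₁ n₂ H₁ H₂)[(j : ℕ) + n₂ * a] = xRow n₁ n₂ H₁ H₂ a j := by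
  have hn₂ : 0 < n₂ := by have := j.2; omega
  simp only [hgpXRows, List.getElem_map, List.getElem_range]
  rw [Nat.add_mul_div_left _ _ hn₂, Nat.div_eq_of_lt j.2, zero_add, Nat.add_mul_mod_self_left, Nat.mod_eq_of_lt j.2]

/-- Row `i·m₂ + b` of the flat `Z`-list is `zRow i b`. [folklore] -/
theorem getElem_hgpZRows (n₁ n₂ : ℕ) (H₁ H₂ : List ℕ) (i : Fin n₁) (b : Fin H₂.length)
    (h : (b : ℕ) + H₂.length * i < (hgpZRows n₁ n₂ H₁ H₂).length) :
    (hgpZRows n₁ n₂ H₁ H₂)[(b : ℕ) + H₂.length * i] = zRow n₁ n₂ H₁ H₂ i b := by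
  have hm₂ : 0 < H₂.length := by have := b.2; omega
  simp only [hgpZRows, List.getElem_map, List.getElem_range]
  rw [Nat.add_mul_div_left _ _ hm₂, Nat.div_eq_of_lt b.2, zero_add, Nat.add_mul_mod_self_left, Nat.mod_eq_of_lt b.2]

/-- Bits of `xRow a j` in block one: position `j' + n₂ i` is set iff `i ∈ supp H₁[a]` and `j' = j`. [folklore] -/
theorem testBit_xRow_inl (n₁ n₂ : ℕ) (H₁ H₂ : List ℕ) (a : Fin H₁.length) (j : Fin n₂) (i : Fin n₁) (j' : Fin n₂) :
    (xRow n₁ n₂ H₁ H₂ a j).testBit ((j' : ℕ) + n₂ * i) = (H₁[(a : ℕ)].testBit i && decide (j = j')) := by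
  have hget : H₁.getD a 0 = H₁[(a : ℕ)] := by
    rw [List.getD_eq_getElem?_getD, List.getElem?_eq_getElem a.2, Option.getD_some]
  rw [xRow, Nat.testBit_or, hget]
  have h2 : (spread (colMask H₂ j) 1 (n₁ * n₂ + a * H₂.length) H₂.length).testBit ((j' : ℕ) + n₂ * i) = false := by
    rw [Bool.eq_false_iff, ne_eq, testBit_spread]
    rintro ⟨b, -, -, hb⟩
    have := blockOne_lt i.2 j'.2
    omega
  rw [h2, Bool.or_false]
  apply Bool.eq_iff_iff.2
  rw [testBit_spread, Bool.and_eq_true, decide_eq_true_iff]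
  constructor
  · rintro ⟨i₀, -, hbit, hpos⟩
    rw [Nat.mul_comm i₀ n₂] at hpos
    obtain ⟨h1, h2⟩ := blockOne_inj j.2 j'.2 hpos
    subst h1
    exact ⟨hbit, Fin.ext h2⟩
  · rintro ⟨hbit, hjj⟩
    exact ⟨i, i.2, hbit, by subst hjj; ring⟩

/-- Bits of `xRow a j` in block two: position `n₁n₂ + b + m₂ a'` is set iff `a' = a` and `j ∈ supp H₂[b]`. [folklore] -/
theorem testBit_xRow_inr (n₁ n₂ : ℕ) (H₁ H₂ : List ℕ) (a : Fin H₁.length) (j : Fin n₂) (a' : Fin H₁.length)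
    (b : Fin H₂.length) :
    (xRow n₁ n₂ H₁ H₂ a j).testBit (n₁ * n₂ + ((b : ℕ) + H₂.length * a')) = (decide (a = a') && H₂[(b : ℕ)].testBit j) := by
  rw [xRow, Nat.testBit_or]
  have h1 : (spread (H₁.getD a 0) n₂ j n₁).testBit (n₁ * n₂ + ((b : ℕ) + H₂.length * a')) = false := by
    rw [Bool.eq_false_iff, ne_eq, testBit_spread]
    rintro ⟨i, hi, -, hpos⟩
    have := blockOne_lt hi j.2
    rw [Nat.mul_comm i] at hpos
    omega
  rw [h1, Bool.false_or]
  apply Bool.eq_iff_iff.2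
  rw [testBit_spread, Bool.and_eq_true, decide_eq_true_iff]
  constructor
  · rintro ⟨b₀, hb₀, hbit, hpos⟩
    have hpos' : (b₀ : ℕ) + H₂.length * a = b + H₂.length * a' := by rw [Nat.mul_comm] ; omega
    obtain ⟨haa, hbb⟩ := blockOne_inj hb₀ b.2 hpos'
    refine ⟨Fin.ext haa, ?_⟩
    rw [testBit_colMask H₂ j b₀ hb₀] at hbit
    subst hbb
    exact hbit
  · rintro ⟨haa, hbit⟩
    refine ⟨b, b.2, by rw [testBit_colMask H₂ j b b.2]; exact hbit, ?_⟩
    subst haa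
    ring

/-- Bits of `zRow i b` in block one: position `j + n₂ i'` is set iff `i' = i` and `j ∈ supp H₂[b]`. [folklore] -/
theorem testBit_zRow_inl (n₁ n₂ : ℕ) (H₁ H₂ : List ℕ) (i : Fin n₁) (b : Fin H₂.length) (i' : Fin n₁) (j : Fin n₂) :
    (zRow n₁ n₂ H₁ H₂ i b).testBit ((j : ℕ) + n₂ * i') = (decide (i = i') && H₂[(b : ℕ)].testBit j) := by
  have hget : H₂.getD b 0 = H₂[(b : ℕ)] := by
    rw [List.getD_eq_getElem?_getD, List.getElem?_eq_getElem b.2, Option.getD_some]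
  rw [zRow, Nat.testBit_or, hget]
  have h2 : (spread (colMask H₁ i) H₂.length (n₁ * n₂ + b) H₁.length).testBit ((j : ℕ) + n₂ * i') = false := by
    rw [Bool.eq_false_iff, ne_eq, testBit_spread]
    rintro ⟨a, -, -, hpos⟩
    have := blockOne_lt i'.2 j.2
    omega
  rw [h2, Bool.or_false]
  apply Bool.eq_iff_iff.2
  rw [testBit_spread, Bool.and_eq_true, decide_eq_true_iff]
  constructor
  · rintro ⟨j₀, hj₀, hbit, hpos⟩
    rw [Nat.mul_comm (i : ℕ) n₂] at hpos
    have hpos' : j₀ + n₂ * (i : ℕ) = j + n₂ * i' := by omega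
    obtain ⟨hii, hjj⟩ := blockOne_inj hj₀ j.2 hpos'
    subst hjj
    exact ⟨Fin.ext hii, hbit⟩
  · rintro ⟨hii, hbit⟩
    refine ⟨j, j.2, hbit, ?_⟩
    subst hii
    ring

/-- Bits of `zRow i b` in block two: position `n₁n₂ + b' + m₂ a` is set iff `i ∈ supp H₁[a]` and `b' = b`. [folklore] -/
theorem testBit_zRow_inr (n₁ n₂ : ℕ) (H₁ H₂ : List ℕ) (i : Fin n₁) (b : Fin H₂.length) (a : Fin H₁.length)
    (b' : Fin H₂.length) :
    (zRow n₁ n₂ H₁ H₂ i b).testBit (n₁ * n₂ + ((b' : ℕ) + H₂.length * a)) = (H₁[(a : ℕ)].testBit i && decide (b = b')) := by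
  rw [zRow, Nat.testBit_or]
  have h1 : (spread (H₂.getD b 0) 1 (i * n₂) n₂).testBit (n₁ * n₂ + ((b' : ℕ) + H₂.length * a)) = false := by
    rw [Bool.eq_false_iff, ne_eq, testBit_spread]
    rintro ⟨j, hj, -, hpos⟩
    have := blockOne_lt i.2 hj
    rw [Nat.mul_comm (i : ℕ)] at hpos
    omega
  rw [h1, Bool.false_or]
  apply Bool.eq_iff_iff.2
  rw [testBit_spread, Bool.and_eq_true, decide_eq_true_iff]
  constructor
  · rintro ⟨a₀, ha₀, hbit, hpos⟩
    have hpos' : (b : ℕ) + H₂.length * a₀ = b' + H₂.length * a := by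
      rw [Nat.mul_comm a₀ H₂.length] at hpos
      omega
    obtain ⟨haa, hbb⟩ := blockOne_inj b.2 b'.2 hpos'
    rw [testBit_colMask H₁ i a₀ ha₀] at hbit
    subst haa
    exact ⟨hbit, Fin.ext hbb⟩
  · rintro ⟨hbit, hbb⟩
    refine ⟨a, a.2, by rw [testBit_colMask H₁ i a a.2]; exact hbit, ?_⟩
    subst hbb
    ring

/-! ## The bridge: `HGP.HX/HZ` are the flat matrices re-indexed -/

/-- A product of two `0/1` indicators in `𝔽₂`. [folklore] -/
private theorem ite_mul_ite (p q : Prop) [Decidable p] [Decidable q] :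
    ((if p then 1 else 0 : ZMod 2) * if q then 1 else 0) = if p ∧ q then 1 else 0 := by
  split_ifs <;> simp_all

/-- **`H_X` of `HGP(H₁,H₂)` is the flat `X`-list re-indexed along the layout.** [folklore] -/
theorem HX_eq_submatrix_flat (n₁ n₂ : ℕ) (H₁ H₂ : List ℕ) :
    HGP.HX (rowMatrix n₁ H₁) (rowMatrix n₂ H₂) =
      (rowMatrix (n₁ * n₂ + H₁.length * H₂.length) (hgpXRows n₁ n₂ H₁ H₂)).submatrix
        (xRowEquiv n₁ n₂ H₁ H₂) (qubitEquiv n₁ n₂ H₁.length H₂.length) := by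
  ext ⟨a, j⟩ x
  rw [Matrix.submatrix_apply, HGP.HX_eq]
  -- the flat entry
  have hrow : (hgpXRows n₁ n₂ H₁ H₂)[(xRowEquiv n₁ n₂ H₁ H₂ (a, j) : Fin _)] = xRow n₁ n₂ H₁ H₂ a j := by
    simp only [Fin.getElem_fin, xRowEquiv_val]
    exact getElem_hgpXRows n₁ n₂ H₁ H₂ a j _
  rcases x with ⟨i, j'⟩ | ⟨a', b⟩
  · rw [Matrix.fromCols_apply_inl, Matrix.kroneckerMap_apply, Matrix.one_apply]
    change ofBits n₁ H₁[(a : ℕ)] i * _ = ofBits _ (hgpXRows n₁ n₂ H₁ H₂)[(xRowEquiv n₁ n₂ H₁ H₂ (a, j) : Fin _)] _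
    rw [hrow, ofBits, ofBits, qubitEquiv_inl_val, testBit_xRow_inl, ite_mul_ite]
    simp only [Bool.and_eq_true, decide_eq_true_eq]
  · rw [Matrix.fromCols_apply_inr, Matrix.kroneckerMap_apply, Matrix.one_apply, Matrix.transpose_apply]
    change _ * ofBits n₂ H₂[(b : ℕ)] j = ofBits _ (hgpXRows n₁ n₂ H₁ H₂)[(xRowEquiv n₁ n₂ H₁ H₂ (a, j) : Fin _)] _
    rw [hrow, ofBits, ofBits, qubitEquiv_inr_val, testBit_xRow_inr, ite_mul_ite]
    simp only [Bool.and_eq_true, decide_eq_true_eq]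

/-- **`H_Z` of `HGP(H₁,H₂)` is the flat `Z`-list re-indexed along the layout.** [folklore] -/
theorem HZ_eq_submatrix_flat (n₁ n₂ : ℕ) (H₁ H₂ : List ℕ) :
    HGP.HZ (rowMatrix n₁ H₁) (rowMatrix n₂ H₂) =
      (rowMatrix (n₁ * n₂ + H₁.length * H₂.length) (hgpZRows n₁ n₂ H₁ H₂)).submatrix
        (zRowEquiv n₁ n₂ H₁ H₂) (qubitEquiv n₁ n₂ H₁.length H₂.length) := by
  ext ⟨i, b⟩ x
  rw [Matrix.submatrix_apply, HGP.HZ_eq]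
  have hrow : (hgpZRows n₁ n₂ H₁ H₂)[(zRowEquiv n₁ n₂ H₁ H₂ (i, b) : Fin _)] = zRow n₁ n₂ H₁ H₂ i b := by
    simp only [Fin.getElem_fin, zRowEquiv_val]
    exact getElem_hgpZRows n₁ n₂ H₁ H₂ i b _
  rcases x with ⟨i', j⟩ | ⟨a, b'⟩
  · rw [Matrix.fromCols_apply_inl, Matrix.kroneckerMap_apply, Matrix.one_apply]
    change _ * ofBits n₂ H₂[(b : ℕ)] j = ofBits _ (hgpZRows n₁ n₂ H₁ H₂)[(zRowEquiv n₁ n₂ H₁ H₂ (i, b) : Fin _)] _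
    rw [hrow, ofBits, ofBits, qubitEquiv_inl_val, testBit_zRow_inl, ite_mul_ite]
    simp only [Bool.and_eq_true, decide_eq_true_eq]
  · rw [Matrix.fromCols_apply_inr, Matrix.kroneckerMap_apply, Matrix.one_apply, Matrix.transpose_apply]
    change ofBits n₁ H₁[(a : ℕ)] i * _ = ofBits _ (hgpZRows n₁ n₂ H₁ H₂)[(zRowEquiv n₁ n₂ H₁ H₂ (i, b) : Fin _)] _
    rw [hrow, ofBits, ofBits, qubitEquiv_inr_val, testBit_zRow_inr, ite_mul_ite]
    simp only [Bool.and_eq_true, decide_eq_true_eq]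

/-! ## `[[n, k, d]]` is invariant under relabelling qubits and checks -/

/-- The census predicate depends on the check matrices only. [folklore] -/
theorem CSSCode.isCode_congr {RX RZ Q : Type*} [Fintype RX] [Fintype RZ] [Fintype Q] {C C' : CSSCode RX RZ Q}
    (hX : C.HX = C'.HX) (hZ : C.HZ = C'.HZ) {n k d : ℕ} : C.IsCode n k d ↔ C'.IsCode n k d := by
  obtain ⟨A, B, h⟩ := C
  obtain ⟨A', B', h'⟩ := C'
  cases hX
  cases hZ
  rfl

/-- **`[[n,k,d]]` transport along a relabelling.** If `C'` has check matrices `A.submatrix ρ κ`, `B.submatrix ρ' κ`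
for equivalences `ρ, ρ', κ`, then `C'` is `[[n,k,d]]` iff the code `C` with check matrices `A, B` is: qubit count,
`k = n − rank − rank` (`Matrix.rank_submatrix`) and `cssMinDist` (column and row re-indexing) are invariant. [folklore] -/
theorem CSSCode.isCode_iff_of_submatrix_equiv {RX RZ Q RX' RZ' Q' : Type*} [Fintype RX] [Fintype RZ] [Fintype Q]
    [Fintype RX'] [Fintype RZ'] [Fintype Q'] [DecidableEq Q] [DecidableEq Q']
    (C : CSSCode RX RZ Q) (C' : CSSCode RX' RZ' Q') (ρ : RX' ≃ RX) (ρ' : RZ' ≃ RZ) (κ : Q' ≃ Q)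
    (hX : C'.HX = C.HX.submatrix ρ κ) (hZ : C'.HZ = C.HZ.submatrix ρ' κ) {n k d : ℕ} :
    C'.IsCode n k d ↔ C.IsCode n k d := by
  simp only [CSSCode.IsCode, CSSCode.k_eq, hX, hZ, Matrix.rank_submatrix, Fintype.card_congr κ]
  rw [show C.HX.submatrix (⇑ρ) (⇑κ) = (C.HX.submatrix ρ id).submatrix id κ from rfl,
    show C.HZ.submatrix (⇑ρ') (⇑κ) = (C.HZ.submatrix ρ' id).submatrix id κ from rfl,
    cssMinDist_submatrix_equiv, cssMinDist_submatrix_equiv_rows]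

/-! ## The flat code of a census row -/

/-- The flat check matrices commute (`H_X H_Zᵀ = 0`), transported from `HGP.HX_mul_HZ_transpose`. [folklore] -/
theorem flat_comm (n₁ n₂ : ℕ) (H₁ H₂ : List ℕ) :
    rowMatrix (n₁ * n₂ + H₁.length * H₂.length) (hgpXRows n₁ n₂ H₁ H₂) *
      (rowMatrix (n₁ * n₂ + H₁.length * H₂.length) (hgpZRows n₁ n₂ H₁ H₂))ᵀ = 0 := by
  have h := HGP.HX_mul_HZ_transpose (rowMatrix n₁ H₁) (rowMatrix n₂ H₂)
  rw [HX_eq_submatrix_flat, HZ_eq_submatrix_flat, Matrix.transpose_submatrix, Matrix.submatrix_mul_equiv] at h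
  have h' := congrArg (fun M => M.submatrix (xRowEquiv n₁ n₂ H₁ H₂).symm (zRowEquiv n₁ n₂ H₁ H₂).symm) h
  simpa only [Matrix.submatrix_submatrix, Equiv.self_comp_symm, Matrix.submatrix_id_id, Matrix.submatrix_zero,
    Pi.zero_apply] using h'

/-- **The flat CSS code of `HGP(H₁,H₂)`**: check matrices = the flat row lists (the gens-file object), commutation
from `flat_comm`. Column: definition. [folklore] -/
def hgpFlatCode (n₁ n₂ : ℕ) (H₁ H₂ : List ℕ) :
    CSSCode (Fin (hgpXRows n₁ n₂ H₁ H₂).length) (Fin (hgpZRows n₁ n₂ H₁ H₂).length)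
      (Fin (n₁ * n₂ + H₁.length * H₂.length)) :=
  CSSCode.ofMatrices _ _ (flat_comm n₁ n₂ H₁ H₂)

/-- **Bridge theorem.** A census theorem `(HGP.code (rowMatrix n₁ H₁) (rowMatrix n₂ H₂)).IsCode n k d` holds iff
the FLAT code (check lists `hgpXRows`, `hgpZRows` = the gens-file `HX`/`HZ` under qec-search-4's layout) is an
`[[n, k, d]]` code. [folklore] -/
theorem HGP.isCode_flat_iff (n₁ n₂ : ℕ) (H₁ H₂ : List ℕ) {n k d : ℕ} :
    (hgpFlatCode n₁ n₂ H₁ H₂).IsCode n k d ↔ (HGP.code (rowMatrix n₁ H₁) (rowMatrix n₂ H₂)).IsCode n k d :=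
  (CSSCode.isCode_iff_of_submatrix_equiv (hgpFlatCode n₁ n₂ H₁ H₂) (HGP.code (rowMatrix n₁ H₁) (rowMatrix n₂ H₂))
    (xRowEquiv n₁ n₂ H₁ H₂) (zRowEquiv n₁ n₂ H₁ H₂) (qubitEquiv n₁ n₂ H₁.length H₂.length)
    (HX_eq_submatrix_flat n₁ n₂ H₁ H₂) (HZ_eq_submatrix_flat n₁ n₂ H₁ H₂)).symm

/-- **Flat `[[n,k,d]]` with literal check lists.** If the flat lists evaluate to given numerals `HXl`, `HZl` (a
`decide` per census row), the CSS code with check matrices `rowMatrix N HXl`, `rowMatrix N HZl` is `[[n,k,d]]`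
whenever `HGP(H₁,H₂)` is. [folklore] -/
theorem HGP.isCode_flat_of_eq (n₁ n₂ : ℕ) (H₁ H₂ : List ℕ) {N : ℕ} {HXl HZl : List ℕ}
    (hN : n₁ * n₂ + H₁.length * H₂.length = N) (hX : hgpXRows n₁ n₂ H₁ H₂ = HXl) (hZ : hgpZRows n₁ n₂ H₁ H₂ = HZl)
    (hc : rowMatrix N HXl * (rowMatrix N HZl)ᵀ = 0) {n k d : ℕ}
    (h : (HGP.code (rowMatrix n₁ H₁) (rowMatrix n₂ H₂)).IsCode n k d) :
    (CSSCode.ofMatrices (rowMatrix N HXl) (rowMatrix N HZl) hc).IsCode n k d := by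
  subst hN hX hZ
  exact (HGP.isCode_flat_iff n₁ n₂ H₁ H₂).2 h

/-! ## Control: `HGP(rep3, ham3)` = census row `HGP_rep3_x_ham3` flattened -/

/-- The flat `X`-list of `HGP(rep3, ham3)` is the gens file's `HX` (census/search-4/gens/B1core/HGP_rep3_x_ham3.json:
`[[0,7,21],[1,8,22],…]` ↦ numerals), by `decide`. CONTROL. [folklore] -/
theorem hgpXRows_rep3_ham3 : hgpXRows 3 7 [3, 6] [85, 102, 120] =
    [2097281, 4194562, 6291972, 8389640, 10487824, 12587040, 14688320, 16793728, 33587456, 50397696, 67240960,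
      84150272, 101191680, 118497280] := by
  decide

/-- The flat `Z`-list of `HGP(rep3, ham3)` is the gens file's `HZ`, by `decide`. CONTROL. [folklore] -/
theorem hgpZRows_rep3_ham3 : hgpZRows 3 7 [3, 6] [85, 102, 120] =
    [2097237, 4194406, 8388728, 18885248, 37761792, 75512832, 18169856, 35225600, 69074944] := by
  decide

end Summit.Ventures.QEC.Census
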